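import Literature.AlgebraicGeometry.Resolution.WeightedBlowupInvNoIncrease
import Literature.AlgebraicGeometry.Resolution.WeightedBlowupMonomialValuation
import Literature.AlgebraicGeometry.Resolution.WeightedCentreDirectrix

/-!
# The set `W(f)` of invariants of the centres admissible for `f`, and its first block

[ATW24] Abramovich–Temkin–Włodarczyk, *Functorial embedded resolution via weighted blowings up*,
Algebra & Number Theory 18:8 (2024) 1557–1587: Def. 2.4.1 (p. 1568: a center
`J = (x₁^{a₁}, …, x_k^{a_k})`, `x` a regular system of parameters, `a_j ∈ ℚ_{>0}`; admissibility
`J ≤ v(I)`), §5.1 (p. 1575: "We order the set of invariants lexicographically, with truncated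
sequences considered larger"), Thm. 5.3.1 (2) (p. 1578):
"`inv_I(p) = max_{(x'₁^{b₁},…,x'_k^{b_k}) ≤ v(I)} (b₁, …, b_k)`, in other words, `inv_I(p)` is the
maximal invariant of a center admissible for `I`", and its proof (p. 1578: "Note that `b₁ ≤ a₁`
…  after reordering … `(x₁, x'₂, …, x'ₙ)` is a regular system of parameters").
[AQS24] Abramovich–Quek–Schober, proof of Thm. 4.2 ("Uniqueness of `a₁`": an admissible centre's
first entry is at most the order).  [CoP1] Cossart–Piltant 2008, proof of Prop. 4.2
(`τ(x) = dim T_x`, the directrix).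

## The model and what is proved

Polynomial model at the origin of `𝔸ⁿ_k` (`k` a field): a CENTRE FOR `f ∈ k[X₁, …, Xₙ]` is a change
of coordinates `Ψ` (a `k`-algebra automorphism of `k[X]` fixing the origin, new parameters
`zᵢ = Ψ(Xᵢ)`) together with a cocharacter `γ : Fin n → ℚ_{≥0}` (`γᵢ = 1/bᵢ` on the centre
variables, `0` elsewhere) such that `(zᵢ^{1/γᵢ})` is admissible for `f`, i.e. `v_γ(g) ≥ 1` on the
monomials of `g = Ψ⁻¹ f` (`f` written in the `z`) — `IsCentreFor f Ψ γ`.  Its invariant is the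
sorted exponent list `exps γ = (b₁ ≤ b₂ ≤ ⋯)` of `WeightedBlowupInvNoIncrease`, compared by
`ATW.TruncLex.lt`.  **`admissibleInvariants f` ("`W(f)`") is the set of these lists** — the
polynomial-coordinate part of the index set of the maximum in [ATW24, Thm. 5.3.1 (2)] (there: all
centres of the regular local ring, étale locally; here: those presented by polynomial automorphisms).

For `f` of order `ν` at the origin (`monomialOrd 𝟙 f = ν`) and `τ := τ(in_ν f)`
(`hironakaTau k {homogeneousComponent ν f}`) we prove, for EVERY centre `(Ψ, γ)` for `f`:
* `exists_inv_nu_le` / `exists_mem_exps_le` — **`b₁ ≤ ν`**: some `γᵢ ≥ 1/ν`, i.e. some entry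
  of the invariant is `≤ ν` [AQS24; ATW24 p. 1578 "`b₁ ≤ a₁`"];
* `hironakaTau_le_card_inv_nu` — **if all entries are `≥ ν` (equivalently `b₁ = ν`) then at least
  `τ` of them equal `ν`** (`τ ≤ #{i : γᵢ = 1/ν}`): the rational centre is put in integer normal
  form (`wᵢ = D·ν·γᵢ`, `N = D·ν`, `W = D`) and `WeightedCentreDirectrix.hironakaTau_le_card_of_admissible`
  applies [ATW24, proof of Thm. 5.3.1 (2)–(3); CoP1]; and `directrix_eq_span_of_isCentreFor` — with
  at most (hence exactly) `τ` entries `ν` the linear parts of those parameters SPAN `T(in_ν f)`;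
* `replicate_prefix_or_lt` — hence **the dichotomy: either `(ν, …, ν)` (`τ` entries) is a PREFIX of
  the invariant, or the invariant is `TruncLex`-SMALLER than `(ν^τ)`** (its first entry is `< ν`);
  and `singleton_prefix_or_lt` (the case of position `1` alone);
* `isCentreFor_refl` / `replicate_mem_admissibleInvariants` — the centre
  `(X₁^ν, …, Xₙ^ν)` is admissible with invariant `(ν, …, ν)` (`n` entries), which has the prefix
  `(ν^τ)` (`τ ≤ n`).
So positions `1, …, τ` of a `TruncLex`-maximal element of `W(f)` read `ν` (existence of the maximum
is neither used nor claimed; [ATW24, Thm. 5.3.1 (2)] identifies the maximum over ALL centres with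
`inv_I(p)` in characteristic `0`): the "block `0`" certificate of the observatory's maximality census,
now against every competitor of the polynomial model at once.

Everything is elementary and proved here; no published theorem is asserted as a fact.  Centres given
by formal / étale coordinate changes are outside the polynomial model (the statements transfer
verbatim, the model does not).
-/

noncomputable section

open MvPolynomial

namespace Literature.AlgebraicGeometry.Resolution

namespace WeightedBlowup

variable {k : Type*} [Field k] {n : ℕ}

/-! ## §1 Centres for `f` in the polynomial model and the set `W(f)` of their invariants -/

/-- **A centre for `f`** (polynomial model): a `k`-algebra automorphism `Ψ` of `k[X]` fixing the
origin (new regular parameters `zᵢ = Ψ Xᵢ`) and a cocharacter `γ ≥ 0` such that the centre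
`(zᵢ^{1/γᵢ} : γᵢ ≠ 0)` is admissible for `f`: `v_γ ≥ 1` on the monomials of `Ψ⁻¹ f`.
[cite: AbramovichTemkinWlodarczyk2024, Def. 2.4.1 (1)–(2) (p. 1568) and Rem. 5.2.3] -/
def IsCentreFor (f : MvPolynomial (Fin n) k) (Ψ : MvPolynomial (Fin n) k ≃ₐ[k] MvPolynomial (Fin n) k)
    (γ : Fin n → ℚ) : Prop :=
  (∀ i, constantCoeff (Ψ (X i)) = 0) ∧ (∀ i, 0 ≤ γ i) ∧ IsAdmissibleFor γ (Ψ.symm f)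

/-- **`W(f)`: the set of invariants `(b₁ ≤ ⋯ ≤ b_k)` of the centres admissible for `f`**
(polynomial model) — the index set of "`inv_I(p) = max_{(x'^b) ≤ v(I)} (b₁, …, b_k)`" restricted to
centres presented by polynomial coordinate changes.
[cite: AbramovichTemkinWlodarczyk2024, Thm. 5.3.1 (2) (p. 1578)] -/
def admissibleInvariants (f : MvPolynomial (Fin n) k) : Set (List ℚ) :=
  {b | ∃ (Ψ : MvPolynomial (Fin n) k ≃ₐ[k] MvPolynomial (Fin n) k) (γ : Fin n → ℚ),
    IsCentreFor f Ψ γ ∧ exps γ = b}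

/-- Membership in `W(f)`. [cite: AbramovichTemkinWlodarczyk2024, Thm. 5.3.1 (2) (p. 1578)] -/
theorem exps_mem_admissibleInvariants {f : MvPolynomial (Fin n) k}
    {Ψ : MvPolynomial (Fin n) k ≃ₐ[k] MvPolynomial (Fin n) k} {γ : Fin n → ℚ}
    (h : IsCentreFor f Ψ γ) : exps γ ∈ admissibleInvariants f :=
  ⟨Ψ, γ, h, rfl⟩

/-- A coordinate change fixing the origin does not change the order at the origin:
`ν_𝟙(Ψ⁻¹ f) = ν_𝟙(f)` (rigidity, all weights `1`).
[cite: AbramovichTemkinWlodarczyk2024, Lemma 5.2.10 (p. 1577)] -/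
theorem monomialOrd_one_symm_eq (Ψ : MvPolynomial (Fin n) k ≃ₐ[k] MvPolynomial (Fin n) k)
    (hΨ : ∀ i, constantCoeff (Ψ (X i)) = 0) (f : MvPolynomial (Fin n) k) :
    monomialOrd (fun _ => 1) (Ψ.symm f) = monomialOrd (fun _ => 1) f :=
  monomialOrd_ringEquiv_symm_eq (fun _ => 1) (Ψ : MvPolynomial (Fin n) k ≃+* MvPolynomial (Fin n) k)
    (fun i => by
      rw [Nat.cast_one]
      exact one_le_monomialOrd_one_of_constantCoeff_eq_zero _ (hΨ i)) f

/-- The monomial valuation of `d` is `Σ_{i ∈ supp d} dᵢ γᵢ`. [folklore] -/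
private theorem monomialValuation_eq_sum (γ : Fin n → ℚ) (d : Fin n →₀ ℕ) :
    monomialValuation γ d = ∑ i ∈ d.support, (d i : ℚ) * γ i := rfl

/-! ## §2 Position 1: `b₁ ≤ ν` -/

/-- **`b₁ ≤ ν = ord f`**: for every centre `(Ψ, γ)` for `f`, some `γᵢ ≥ 1/ν` — a monomial of
`Ψ⁻¹ f` of degree `ν` has `v_γ ≥ 1`, impossible if all `γᵢ < 1/ν`.
[cite: AbramovichQuekSchober2024, proof of Thm. 4.2 ("Uniqueness of a₁")];
[cite: AbramovichTemkinWlodarczyk2024, proof of Thm. 5.3.1 (2) (p. 1578) ("b₁ ≤ a₁")] -/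
theorem exists_inv_nu_le {f : MvPolynomial (Fin n) k} {ν : ℕ}
    (hν : monomialOrd (fun _ => 1) f = ν)
    {Ψ : MvPolynomial (Fin n) k ≃ₐ[k] MvPolynomial (Fin n) k} {γ : Fin n → ℚ}
    (h : IsCentreFor f Ψ γ) : ∃ i, (ν : ℚ)⁻¹ ≤ γ i := by
  obtain ⟨hΨ, hγ, hadm⟩ := h
  have hg : monomialOrd (fun _ => 1) (Ψ.symm f) = ν := by rw [monomialOrd_one_symm_eq Ψ hΨ f, hν]
  have hg0 : Ψ.symm f ≠ 0 := by
    intro h0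
    rw [h0, monomialOrd_zero] at hg
    exact ENat.top_ne_coe ν hg
  obtain ⟨d, hd, hdw⟩ := exists_weight_eq_monomialOrd (fun _ => 1) hg0
  rw [hg, Nat.cast_inj, ← Finsupp.degree_eq_weight_one] at hdw
  have h1 : (1 : ℚ) ≤ monomialValuation γ d := hadm d hd
  by_contra hcon
  rw [not_exists] at hcon
  rw [monomialValuation_eq_sum] at h1
  by_cases hd0 : d.support = ∅
  · rw [hd0, Finset.sum_empty] at h1
    exact absurd h1 (by norm_num)
  · have hlt : ∑ i ∈ d.support, (d i : ℚ) * γ i < ∑ i ∈ d.support, (d i : ℚ) * (ν : ℚ)⁻¹ :=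
      Finset.sum_lt_sum_of_nonempty (Finset.nonempty_iff_ne_empty.mpr hd0) fun i hi =>
        mul_lt_mul_of_pos_left (lt_of_not_ge (hcon i))
          (by exact_mod_cast Nat.pos_of_ne_zero (Finsupp.mem_support_iff.mp hi))
    rw [← Finset.sum_mul, ← Nat.cast_sum, ← Finsupp.degree_apply, hdw] at hlt
    have hν0 : (ν : ℚ) ≠ 0 := by
      rintro hz
      rw [hz, inv_zero, mul_zero] at hlt
      exact absurd (h1.trans_lt hlt) (by norm_num)
    rw [mul_inv_cancel₀ hν0] at hlt
    exact absurd (h1.trans_lt hlt) (lt_irrefl _)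

/-- The order of an `f` admitting a centre is positive (`f(0) = 0`). [folklore] -/
private theorem nu_pos {f : MvPolynomial (Fin n) k} {ν : ℕ} (hν : monomialOrd (fun _ => 1) f = ν)
    {Ψ : MvPolynomial (Fin n) k ≃ₐ[k] MvPolynomial (Fin n) k} {γ : Fin n → ℚ}
    (h : IsCentreFor f Ψ γ) : 0 < ν := by
  obtain ⟨i, hi⟩ := exists_inv_nu_le hν h
  by_contra h0
  -- ν = 0: then `0⁻¹ = 0 ≤ γ i` is no contradiction by itself; redo the valuation argument
  obtain ⟨hΨ, hγ, hadm⟩ := h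
  have hz : ν = 0 := by omega
  subst hz
  have hg : monomialOrd (fun _ => 1) (Ψ.symm f) = (0 : ℕ) := by
    rw [monomialOrd_one_symm_eq Ψ hΨ f, hν]
  have hg0 : Ψ.symm f ≠ 0 := by
    intro h0
    rw [h0, monomialOrd_zero] at hg
    exact ENat.top_ne_coe 0 hg
  obtain ⟨d, hd, hdw⟩ := exists_weight_eq_monomialOrd (fun _ => 1) hg0
  rw [hg, Nat.cast_inj, ← Finsupp.degree_eq_weight_one, Finsupp.degree_eq_zero_iff] at hdw
  subst hdw
  have h1 : (1 : ℚ) ≤ monomialValuation γ 0 := hadm 0 hd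
  rw [monomialValuation_eq_sum, Finsupp.support_zero, Finset.sum_empty] at h1
  exact absurd h1 (by norm_num)

/-- An entry of the invariant: `(γ i)⁻¹ ∈ exps γ` for `γ i ≠ 0`. [folklore] -/
private theorem inv_mem_exps {γ : Fin n → ℚ} {i : Fin n} (hi : γ i ≠ 0) : (γ i)⁻¹ ∈ exps γ := by
  unfold exps
  rw [List.mem_insertionSort, List.mem_map]
  exact ⟨i, Finset.mem_toList.mpr (Finset.mem_filter.mpr ⟨Finset.mem_univ _, hi⟩), rfl⟩

/-- Entries of the invariant are inverses of nonzero `γ i`. [folklore] -/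
private theorem exists_eq_inv_of_mem_exps {γ : Fin n → ℚ} {x : ℚ} (hx : x ∈ exps γ) :
    ∃ i, γ i ≠ 0 ∧ x = (γ i)⁻¹ := by
  unfold exps at hx
  rw [List.mem_insertionSort, List.mem_map] at hx
  obtain ⟨i, hi, rfl⟩ := hx
  exact ⟨i, (Finset.mem_filter.mp (Finset.mem_toList.mp hi)).2, rfl⟩

/-- **Position 1 in list form**: the invariant of every centre for `f` has an entry `≤ ν`.
[cite: AbramovichQuekSchober2024, proof of Thm. 4.2 ("Uniqueness of a₁")];
[cite: AbramovichTemkinWlodarczyk2024, proof of Thm. 5.3.1 (2) (p. 1578)] -/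
theorem exists_mem_exps_le {f : MvPolynomial (Fin n) k} {ν : ℕ}
    (hν : monomialOrd (fun _ => 1) f = ν)
    {Ψ : MvPolynomial (Fin n) k ≃ₐ[k] MvPolynomial (Fin n) k} {γ : Fin n → ℚ}
    (h : IsCentreFor f Ψ γ) : ∃ x ∈ exps γ, x ≤ ν := by
  have hν0 : (0 : ℚ) < ν := by exact_mod_cast nu_pos hν h
  obtain ⟨i, hi⟩ := exists_inv_nu_le hν h
  have hγi : 0 < γ i := lt_of_lt_of_le (inv_pos.mpr hν0) hi
  exact ⟨(γ i)⁻¹, inv_mem_exps hγi.ne', inv_le_of_inv_le₀ hν0 hi⟩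

/-- `W(f)` in words: every invariant of a centre for `f` has an entry `≤ ν` (so its first entry is
`≤ ν`). [cite: AbramovichTemkinWlodarczyk2024, Thm. 5.3.1 (2) and its proof (p. 1578)] -/
theorem exists_mem_le_of_mem_admissibleInvariants {f : MvPolynomial (Fin n) k} {ν : ℕ}
    (hν : monomialOrd (fun _ => 1) f = ν) {b : List ℚ} (hb : b ∈ admissibleInvariants f) :
    ∃ x ∈ b, x ≤ ν := by
  obtain ⟨Ψ, γ, h, rfl⟩ := hb
  exact exists_mem_exps_le hν h

/-! ## §3 Positions `2, …, τ`: integer normal form and the directrix bound -/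

/-- **Integer normal form of a rational centre.**  For `γ ≥ 0` with all `γᵢ ≤ 1/ν` put
`D := ∏ᵢ den(γᵢ)` and `wᵢ := D·ν·γᵢ ∈ ℕ`; then `wᵢ ≤ D`, `wᵢ = D ⟺ γᵢ = 1/ν`, and admissibility
of `γ` is `D·ν ≤ ν_w`. [cite: AbramovichTemkinWlodarczyk2024, Def. 2.4.1 (3) (p. 1568) (reduced
center: integer weights)] -/
theorem exists_integer_normal_form (γ : Fin n → ℚ) (hγ : ∀ i, 0 ≤ γ i) {ν : ℕ} (hν : 0 < ν)
    (hle : ∀ i, γ i ≤ (ν : ℚ)⁻¹) :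
    ∃ (D : ℕ) (w : Fin n → ℕ), 0 < D ∧ (∀ i, (w i : ℚ) = ((D * ν : ℕ) : ℚ) * γ i) ∧
      (∀ i, w i ≤ D) ∧ (∀ i, w i = D ↔ γ i = (ν : ℚ)⁻¹) := by
  classical
  set D : ℕ := ∏ j, (γ j).den with hD
  have hDpos : 0 < D := Finset.prod_pos fun j _ => (γ j).den_pos
  have hν0 : (0 : ℚ) < ν := by exact_mod_cast hν
  -- `E i = ∏_{j ≠ i} den(γ j)`, `w i = ν · E i · num(γ i)`
  set E : Fin n → ℕ := fun i => ∏ j ∈ Finset.univ.erase i, (γ j).den with hE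
  set w : Fin n → ℕ := fun i => ν * E i * (γ i).num.toNat with hw
  have hDq : ∀ i, (D : ℚ) = ((γ i).den : ℚ) * (E i : ℚ) := fun i => by
    have h := Finset.mul_prod_erase Finset.univ (fun j => (γ j).den) (Finset.mem_univ i)
    rw [hD, hE]
    exact_mod_cast h.symm
  have hkey : ∀ i, (w i : ℚ) = (ν : ℚ) * D * γ i := fun i => by
    have hnum : (((γ i).num.toNat : ℕ) : ℚ) = ((γ i).num : ℚ) := by
      have h := Int.toNat_of_nonneg (Rat.num_nonneg.mpr (hγ i))
      exact_mod_cast h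
    rw [hw]
    push_cast
    rw [hnum, ← Rat.mul_den_eq_num (γ i), hDq i]
    ring
  refine ⟨D, w, hDpos, fun i => ?_, fun i => ?_, fun i => ?_⟩
  · rw [hkey i]; push_cast; ring
  · have h1 : (ν : ℚ) * γ i ≤ 1 := by
      calc (ν : ℚ) * γ i ≤ ν * (ν : ℚ)⁻¹ := mul_le_mul_of_nonneg_left (hle i) hν0.le
        _ = 1 := mul_inv_cancel₀ hν0.ne'
    have hq : (w i : ℚ) ≤ D := by
      calc (w i : ℚ) = ((ν : ℚ) * γ i) * D := by rw [hkey i]; ring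
        _ ≤ 1 * D := mul_le_mul_of_nonneg_right h1 (Nat.cast_nonneg _)
        _ = D := one_mul _
    exact_mod_cast hq
  · have hD0 : (D : ℚ) ≠ 0 := by exact_mod_cast hDpos.ne'
    rw [← Nat.cast_inj (R := ℚ), hkey i]
    constructor
    · intro heq
      have h2 : (ν : ℚ) * γ i = 1 := by
        apply mul_right_cancel₀ hD0
        linear_combination heq
      exact ((mul_eq_one_iff_inv_eq₀ hν0.ne').mp h2).symm
    · intro heq
      rw [heq, mul_assoc, mul_comm (D : ℚ), ← mul_assoc, mul_inv_cancel₀ hν0.ne', one_mul]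

/-- **If every entry of the invariant is `≥ ν` then at least `τ(in_ν f)` of them equal `ν`**:
for a centre `(Ψ, γ)` for `f` with `γᵢ ≤ 1/ν` for all `i`, `τ ≤ #{i : γᵢ = 1/ν}` — the integer
normal form of §3 and `hironakaTau_le_card_of_admissible`.
[cite: AbramovichTemkinWlodarczyk2024, proof of Thm. 5.3.1 (2)–(3) (p. 1578)];
[cite: CossartPiltant2008, proof of Prop. 4.2] -/
theorem hironakaTau_le_card_inv_nu {f : MvPolynomial (Fin n) k} {ν : ℕ}
    (hν : monomialOrd (fun _ => 1) f = ν)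
    {Ψ : MvPolynomial (Fin n) k ≃ₐ[k] MvPolynomial (Fin n) k} {γ : Fin n → ℚ}
    (h : IsCentreFor f Ψ γ) (hle : ∀ i, γ i ≤ (ν : ℚ)⁻¹) :
    hironakaTau k {homogeneousComponent ν f} ≤
      (Finset.univ.filter fun i => γ i = (ν : ℚ)⁻¹).card := by
  classical
  have hν0 : 0 < ν := nu_pos hν h
  obtain ⟨hΨ, hγ, hadm⟩ := h
  obtain ⟨D, w, hD, hw, hwD, hwiff⟩ := exists_integer_normal_form γ hγ hν0 hle
  have hN : 0 < D * ν := Nat.mul_pos hD hν0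
  have hadm' : ((D * ν : ℕ) : ℕ∞) ≤ monomialOrd w (Ψ.symm f) :=
    (isAdmissibleFor_iff_le_monomialOrd γ w hN hw (Ψ.symm f)).mp hadm
  have hτ := hironakaTau_le_card_of_admissible Ψ hΨ f w hD hwD hadm'
  rwa [Finset.filter_congr (fun i _ => hwiff i)] at hτ

/-- Counting form: at least `τ` entries of `exps γ` are `≤ ν` (indeed `= ν`).
[cite: AbramovichTemkinWlodarczyk2024, proof of Thm. 5.3.1 (2)–(3) (p. 1578)] -/
theorem hironakaTau_le_countP_exps {f : MvPolynomial (Fin n) k} {ν : ℕ}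
    (hν : monomialOrd (fun _ => 1) f = ν)
    {Ψ : MvPolynomial (Fin n) k ≃ₐ[k] MvPolynomial (Fin n) k} {γ : Fin n → ℚ}
    (h : IsCentreFor f Ψ γ) (hle : ∀ i, γ i ≤ (ν : ℚ)⁻¹) :
    hironakaTau k {homogeneousComponent ν f} ≤
      (exps γ).countP fun x => decide (x ≤ (ν : ℚ)) := by
  classical
  have hν0 : (0 : ℚ) < ν := by exact_mod_cast nu_pos hν h
  rw [countP_exps]
  refine (hironakaTau_le_card_inv_nu hν h hle).trans (Finset.card_le_card fun i hi => ?_)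
  rw [Finset.mem_filter] at hi ⊢
  refine ⟨hi.1, ?_, ?_⟩
  · rw [hi.2]; exact inv_ne_zero hν0.ne'
  · rw [hi.2, inv_inv]

/-- **Equality case: a centre with at most (hence exactly) `τ` entries equal to `ν` (and none
below) presents the directrix** — `T(in_ν f)` is the span of the linear parts of its parameters
`zᵢ = Ψ Xᵢ` with `γᵢ = 1/ν` (`WeightedCentreDirectrix.directrix_eq_span_of_admissible` in the
integer normal form).
[cite: AbramovichTemkinWlodarczyk2024, proof of Thm. 5.3.1 (2)–(3) (p. 1578)];
[cite: CossartPiltant2008, proof of Prop. 4.2 (T_x minimal, τ(x) = dim T_x)] -/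
theorem directrix_eq_span_of_isCentreFor {f : MvPolynomial (Fin n) k} {ν : ℕ}
    (hν : monomialOrd (fun _ => 1) f = ν)
    {Ψ : MvPolynomial (Fin n) k ≃ₐ[k] MvPolynomial (Fin n) k} {γ : Fin n → ℚ}
    (h : IsCentreFor f Ψ γ) (hle : ∀ i, γ i ≤ (ν : ℚ)⁻¹)
    (hτ : (Finset.univ.filter fun i => γ i = (ν : ℚ)⁻¹).card ≤
      hironakaTau k {homogeneousComponent ν f}) :
    directrix k {homogeneousComponent ν f} =
      (Submodule.span k
        ((fun i => homogeneousComponent 1 (Ψ (X i))) '' {i | γ i = (ν : ℚ)⁻¹})).comap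
        (linearFormPolyₗ k) := by
  classical
  have hν0 : 0 < ν := nu_pos hν h
  obtain ⟨hΨ, hγ, hadm⟩ := h
  obtain ⟨D, w, hD, hw, hwD, hwiff⟩ := exists_integer_normal_form γ hγ hν0 hle
  have hN : 0 < D * ν := Nat.mul_pos hD hν0
  have hadm' : ((D * ν : ℕ) : ℕ∞) ≤ monomialOrd w (Ψ.symm f) :=
    (isAdmissibleFor_iff_le_monomialOrd γ w hN hw (Ψ.symm f)).mp hadm
  have hτ' : (Finset.univ.filter fun i => w i = D).card ≤
      hironakaTau k {homogeneousComponent ν f} := by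
    rwa [Finset.filter_congr (fun i _ => hwiff i)]
  have hset : {i : Fin n | w i = D} = {i | γ i = (ν : ℚ)⁻¹} := Set.ext fun i => hwiff i
  have hmain := directrix_eq_span_of_admissible Ψ hΨ f w hD hwD hadm' hτ'
  rwa [hset] at hmain

/-! ## §4 The first block is attained: the centre `(X₁^ν, …, Xₙ^ν)` -/

/-- **The point-blowup centre `(Xᵢ^ν)ᵢ` is a centre for `f`** (`ord f = ν ≥ 1`): every monomial
of `f` has degree `≥ ν`, so `v(d) = |d|/ν ≥ 1`.
[cite: AbramovichTemkinWlodarczyk2024, Def. 2.4.1 (2) and Rem. 5.2.3 (admissibility on monomials)] -/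
theorem isCentreFor_refl {f : MvPolynomial (Fin n) k} {ν : ℕ}
    (hν : monomialOrd (fun _ => 1) f = ν) (hν0 : 0 < ν) :
    IsCentreFor f AlgEquiv.refl (fun _ => (ν : ℚ)⁻¹) := by
  have hν0' : (0 : ℚ) < ν := by exact_mod_cast hν0
  refine ⟨fun i => constantCoeff_X k i, fun _ => inv_nonneg.mpr hν0'.le, fun d hd => ?_⟩
  have hdeg : ν ≤ d.degree := (le_monomialOrd_one_iff f ν).mp hν.ge d hd
  rw [monomialValuation_eq_sum, ← Finset.sum_mul, ← Nat.cast_sum, ← Finsupp.degree_apply]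
  rw [le_mul_inv_iff₀ hν0', one_mul]
  exact_mod_cast hdeg

/-- Its invariant is `(ν, …, ν)` (`n` entries). [folklore: sorting a constant list] -/
private theorem exps_const_inv {ν : ℕ} (hν0 : 0 < ν) :
    exps (fun _ : Fin n => (ν : ℚ)⁻¹) = List.replicate n (ν : ℚ) := by
  classical
  have hν0' : (ν : ℚ) ≠ 0 := by exact_mod_cast hν0.ne'
  unfold exps
  rw [Finset.filter_true_of_mem fun i _ => inv_ne_zero hν0', List.map_const', inv_inv,
    Finset.length_toList, Finset.card_univ, Fintype.card_fin]
  exact (List.pairwise_replicate.mpr (Or.inr le_rfl)).insertionSort_eq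

/-- **`(ν, …, ν) ∈ W(f)`** (`n` entries), and it has the prefix `(ν^τ)` since `τ ≤ n`: together
with `replicate_prefix_or_lt`, positions `1, …, τ` of the maximum of `W(f)` read `ν`.
[cite: AbramovichTemkinWlodarczyk2024, Thm. 5.3.1 (2) (p. 1578)];
[cite: CossartPiltant2008, proof of Prop. 4.2 (τ ≤ emb.dim)] -/
theorem replicate_mem_admissibleInvariants {f : MvPolynomial (Fin n) k} {ν : ℕ}
    (hν : monomialOrd (fun _ => 1) f = ν) (hν0 : 0 < ν) :
    List.replicate n (ν : ℚ) ∈ admissibleInvariants f ∧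
      List.replicate (hironakaTau k {homogeneousComponent ν f}) (ν : ℚ) <+:
        List.replicate n (ν : ℚ) := by
  refine ⟨⟨AlgEquiv.refl, fun _ => (ν : ℚ)⁻¹, isCentreFor_refl hν hν0, exps_const_inv hν0⟩, ?_⟩
  obtain ⟨m, hm⟩ := Nat.exists_eq_add_of_le (hironakaTau_le k {homogeneousComponent ν f})
  refine ⟨List.replicate m (ν : ℚ), ?_⟩
  rw [← List.replicate_add, ← hm]

/-! ## §5 The dichotomy for the first block, and the maximum -/

/-- In a sorted list whose entries are all `≥ ν`, `t` entries `≤ ν` make `(ν, …, ν)` (`t` times)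
a prefix. [folklore] -/
private theorem replicate_prefix_of_sorted (ν : ℚ) :
    ∀ (l : List ℚ), l.Pairwise (· ≤ ·) → (∀ x ∈ l, ν ≤ x) →
      ∀ t, t ≤ l.countP (fun x => decide (x ≤ ν)) → List.replicate t ν <+: l
  | [], _, _, t, ht => by
    simp only [List.countP_nil, Nat.le_zero] at ht
    subst ht
    exact List.nil_prefix
  | x :: l, hs, hge, 0, _ => List.nil_prefix
  | x :: l, hs, hge, t + 1, ht => by
    rw [List.pairwise_cons] at hs
    by_cases hx : x ≤ ν
    · have hxe : x = ν := le_antisymm hx (hge x (by simp))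
      rw [List.replicate_succ, hxe, List.cons_prefix_cons]
      refine ⟨rfl, replicate_prefix_of_sorted ν l hs.2 (fun y hy => hge y (by simp [hy])) t ?_⟩
      simp only [List.countP_cons, hx, decide_true, ite_true] at ht
      omega
    · exfalso
      have h0 : (x :: l).countP (fun y => decide (y ≤ ν)) = 0 := by
        rw [List.countP_eq_zero]
        intro y hy
        simp only [decide_eq_true_eq, not_le]
        rcases List.mem_cons.mp hy with rfl | hy
        · exact lt_of_not_ge hx
        · exact (lt_of_not_ge hx).trans_le (hs.1 y hy)
      omega

/-- The head of a sorted list is `≤` every member. [folklore] -/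
private theorem head_le_of_mem_sorted {x e : ℚ} {es : List ℚ} (hs : (e :: es).Pairwise (· ≤ ·))
    (hx : x ∈ e :: es) : e ≤ x := by
  rw [List.pairwise_cons] at hs
  rcases List.mem_cons.mp hx with rfl | hx
  · exact le_rfl
  · exact hs.1 x hx

/-- Case B of the first block: if all `γᵢ ≤ 1/ν` (all entries of the invariant are `≥ ν`) then
`(ν, …, ν)` (`τ` entries) is a prefix of `exps γ`.
[cite: AbramovichTemkinWlodarczyk2024, proof of Thm. 5.3.1 (2)–(3) (p. 1578)] -/
theorem replicate_prefix_of_forall_le {f : MvPolynomial (Fin n) k} {ν : ℕ}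
    (hν : monomialOrd (fun _ => 1) f = ν)
    {Ψ : MvPolynomial (Fin n) k ≃ₐ[k] MvPolynomial (Fin n) k} {γ : Fin n → ℚ}
    (h : IsCentreFor f Ψ γ) (hle : ∀ i, γ i ≤ (ν : ℚ)⁻¹) :
    List.replicate (hironakaTau k {homogeneousComponent ν f}) (ν : ℚ) <+: exps γ := by
  refine replicate_prefix_of_sorted (ν : ℚ) (exps γ) (exps_sorted γ) (fun x hx => ?_) _
    (hironakaTau_le_countP_exps hν h hle)
  obtain ⟨i, hi, rfl⟩ := exists_eq_inv_of_mem_exps hx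
  have hpos : 0 < γ i := lt_of_le_of_ne (h.2.1 i) (Ne.symm hi)
  exact le_inv_of_le_inv₀ hpos (hle i)

/-- Case A of the first block: if some `γᵢ > 1/ν` (some entry of the invariant is `< ν`) then
`exps γ` is `TruncLex`-smaller than `(ν, …, ν)` (`m ≥ 1` entries): its first entry is `< ν`.
[cite: AbramovichTemkinWlodarczyk2024, §5.1 (p. 1575) (the order) and proof of Thm. 5.3.1 (2)
(p. 1578) ("b₁ ≤ a₁")] -/
theorem truncLex_lt_replicate_of_lt {f : MvPolynomial (Fin n) k} {ν : ℕ}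
    (hν : monomialOrd (fun _ => 1) f = ν)
    {Ψ : MvPolynomial (Fin n) k ≃ₐ[k] MvPolynomial (Fin n) k} {γ : Fin n → ℚ}
    (h : IsCentreFor f Ψ γ) {i : Fin n} (hi : (ν : ℚ)⁻¹ < γ i) {m : ℕ} (hm : 0 < m) :
    ATW.TruncLex.lt (exps γ) (List.replicate m (ν : ℚ)) := by
  have hν0 : (0 : ℚ) < ν := by exact_mod_cast nu_pos hν h
  have hpos : 0 < γ i := (inv_pos.mpr hν0).trans hi
  have hmem : (γ i)⁻¹ ∈ exps γ := inv_mem_exps hpos.ne'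
  have hlt : (γ i)⁻¹ < ν := inv_lt_of_inv_lt₀ hν0 hi
  obtain ⟨t, rfl⟩ := Nat.exists_eq_succ_of_ne_zero hm.ne'
  obtain ⟨e, es, hees⟩ : ∃ e es, exps γ = e :: es := by
    cases hl : exps γ with
    | nil => rw [hl] at hmem; simp at hmem
    | cons e es => exact ⟨e, es, rfl⟩
  rw [hees, List.replicate_succ, ATW.TruncLex.cons_lt_cons]
  left
  have hs := exps_sorted γ
  rw [hees] at hs hmem
  exact (head_le_of_mem_sorted hs hmem).trans_lt hlt

/-- **The first block of `W(f)`.**  For every centre `(Ψ, γ)` for `f` (`ord f = ν`,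
`τ = τ(in_ν f)`): EITHER `(ν, …, ν)` (`τ` entries) is a prefix of its invariant `exps γ`, OR the
invariant is `TruncLex`-smaller than `(ν^τ)` (its first entry is `< ν`).
[cite: AbramovichTemkinWlodarczyk2024, Thm. 5.3.1 (2) and its proof (p. 1578)];
[cite: CossartPiltant2008, proof of Prop. 4.2] -/
theorem replicate_prefix_or_lt {f : MvPolynomial (Fin n) k} {ν : ℕ}
    (hν : monomialOrd (fun _ => 1) f = ν)
    {Ψ : MvPolynomial (Fin n) k ≃ₐ[k] MvPolynomial (Fin n) k} {γ : Fin n → ℚ}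
    (h : IsCentreFor f Ψ γ) :
    List.replicate (hironakaTau k {homogeneousComponent ν f}) (ν : ℚ) <+: exps γ ∨
      ATW.TruncLex.lt (exps γ)
        (List.replicate (hironakaTau k {homogeneousComponent ν f}) (ν : ℚ)) := by
  by_cases hle : ∀ i, γ i ≤ (ν : ℚ)⁻¹
  · exact Or.inl (replicate_prefix_of_forall_le hν h hle)
  · rw [not_forall] at hle
    obtain ⟨i, hi⟩ := hle
    have hi : (ν : ℚ)⁻¹ < γ i := lt_of_not_ge hi
    cases hτ : hironakaTau k {homogeneousComponent ν f} with
    | zero => exact Or.inl List.nil_prefix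
    | succ t => exact Or.inr (truncLex_lt_replicate_of_lt hν h hi t.succ_pos)

/-- **Positions `1, …, τ` of the maximum of `W(f)` read `ν`**: a `TruncLex`-maximal element of
`W(f)` has the prefix `(ν, …, ν)` (`τ = τ(in_ν f)` entries) — Case A is beaten by the admissible
centre `(X₁^ν, …, Xₙ^ν)` (`replicate_mem_admissibleInvariants`).
[cite: AbramovichTemkinWlodarczyk2024, Thm. 5.3.1 (2)–(3) and its proof (p. 1578)];
[cite: CossartPiltant2008, proof of Prop. 4.2] -/
theorem replicate_prefix_of_maximal {f : MvPolynomial (Fin n) k} {ν : ℕ}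
    (hν : monomialOrd (fun _ => 1) f = ν) {b : List ℚ} (hb : b ∈ admissibleInvariants f)
    (hmax : ∀ b' ∈ admissibleInvariants f, ¬ ATW.TruncLex.lt b b') :
    List.replicate (hironakaTau k {homogeneousComponent ν f}) (ν : ℚ) <+: b := by
  obtain ⟨Ψ, γ, h, rfl⟩ := hb
  by_cases hle : ∀ i, γ i ≤ (ν : ℚ)⁻¹
  · exact replicate_prefix_of_forall_le hν h hle
  · exfalso
    rw [not_forall] at hle
    obtain ⟨i, hi⟩ := hle
    have hi : (ν : ℚ)⁻¹ < γ i := lt_of_not_ge hi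
    have hν0 : 0 < ν := nu_pos hν h
    exact hmax _ (replicate_mem_admissibleInvariants hν hν0).1
      (truncLex_lt_replicate_of_lt hν h hi i.pos)

/-- **Position 1 alone**: either `[ν]` is a prefix of the invariant (its first entry is `ν`) or
the invariant is `TruncLex`-smaller than `[ν]` (first entry `< ν`).
[cite: AbramovichTemkinWlodarczyk2024, Thm. 5.3.1 (2) and its proof (p. 1578) ("b₁ ≤ a₁")];
[cite: AbramovichQuekSchober2024, proof of Thm. 4.2] -/
theorem singleton_prefix_or_lt {f : MvPolynomial (Fin n) k} {ν : ℕ}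
    (hν : monomialOrd (fun _ => 1) f = ν)
    {Ψ : MvPolynomial (Fin n) k ≃ₐ[k] MvPolynomial (Fin n) k} {γ : Fin n → ℚ}
    (h : IsCentreFor f Ψ γ) :
    [(ν : ℚ)] <+: exps γ ∨ ATW.TruncLex.lt (exps γ) [(ν : ℚ)] := by
  have hν0 : (0 : ℚ) < ν := by exact_mod_cast nu_pos hν h
  obtain ⟨x, hx, hxν⟩ := exists_mem_exps_le hν h
  obtain ⟨e, es, hees⟩ : ∃ e es, exps γ = e :: es := by
    cases hl : exps γ with
    | nil => rw [hl] at hx; simp at hx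
    | cons e es => exact ⟨e, es, rfl⟩
  have hs := exps_sorted γ
  rw [hees] at hs hx ⊢
  have hex : e ≤ ν := (head_le_of_mem_sorted hs hx).trans hxν
  rcases hex.lt_or_eq with hlt | heq
  · right
    rw [ATW.TruncLex.cons_lt_cons]
    exact Or.inl hlt
  · left
    rw [heq, List.cons_prefix_cons]
    exact ⟨rfl, List.nil_prefix⟩

/-- **Position `i` (`1 ≤ i ≤ τ`) is certified** (the observatory's positional reading): every centre for
`f` whose invariant agrees with `(ν, ν, …)` at the positions before `i` HAS an `i`-th entry, and it is
`≤ ν` (positions are `0`-based here: `i < τ`).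
[cite: AbramovichTemkinWlodarczyk2024, Thm. 5.3.1 (2) and its proof (p. 1578)];
[cite: CossartPiltant2008, proof of Prop. 4.2] -/
theorem exists_getElem_le_of_agree {f : MvPolynomial (Fin n) k} {ν : ℕ}
    (hν : monomialOrd (fun _ => 1) f = ν)
    {Ψ : MvPolynomial (Fin n) k ≃ₐ[k] MvPolynomial (Fin n) k} {γ : Fin n → ℚ}
    (h : IsCentreFor f Ψ γ) {i : ℕ} (hi : i < hironakaTau k {homogeneousComponent ν f})
    (hagree : ∀ j < i, (exps γ)[j]? = some (ν : ℚ)) :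
    ∃ x : ℚ, (exps γ)[i]? = some x ∧ x ≤ ν := by
  by_cases hle : ∀ i, γ i ≤ (ν : ℚ)⁻¹
  · obtain ⟨t, ht⟩ := replicate_prefix_of_forall_le hν h hle
    refine ⟨ν, ?_, le_rfl⟩
    rw [← ht, List.getElem?_append_left (by rw [List.length_replicate]; exact hi),
      List.getElem?_replicate_of_lt hi]
  · rw [not_forall] at hle
    obtain ⟨i₀, hi₀⟩ := hle
    have hi₀ : (ν : ℚ)⁻¹ < γ i₀ := lt_of_not_ge hi₀
    have hν0 : (0 : ℚ) < ν := by exact_mod_cast nu_pos hν h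
    have hpos : 0 < γ i₀ := (inv_pos.mpr hν0).trans hi₀
    have hmem : (γ i₀)⁻¹ ∈ exps γ := inv_mem_exps hpos.ne'
    have hlt : (γ i₀)⁻¹ < ν := inv_lt_of_inv_lt₀ hν0 hi₀
    obtain ⟨e, es, hees⟩ : ∃ e es, exps γ = e :: es := by
      cases hl : exps γ with
      | nil => rw [hl] at hmem; simp at hmem
      | cons e es => exact ⟨e, es, rfl⟩
    have hs := exps_sorted γ
    rw [hees] at hs hmem hagree ⊢
    have he : e < ν := (head_le_of_mem_sorted hs hmem).trans_lt hlt
    cases i with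
    | zero => exact ⟨e, rfl, he.le⟩
    | succ i =>
      exfalso
      have h0 := hagree 0 (Nat.succ_pos i)
      simp only [List.getElem?_cons_zero, Option.some.injEq] at h0
      exact absurd h0 he.ne

end WeightedBlowup

end Literature.AlgebraicGeometry.Resolution

end
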